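import Summits.QuantumFields.YangMills.Theorems.AlphaInputsT3ACv3NewtonLiftFramedLinearisation
import Summits.QuantumFields.YangMills.Theorems.AlphaInputsT3ACv3LinearLiftMatrixTwistCurl
import Summits.QuantumFields.YangMills.Theorems.AlphaInputsT3ACv3LinearLiftMatrixLocal
import HarnessLib

/-!
# `AlphaInputsT3ACv3NewtonLiftFramedInverse` — STRATEGY B for 2′, the (FL) row under OWNER RULING g24-№4, residual (r1): **HYPOTHESES (ii)∕(iii) AND THE CURL ROW OF THE REGIONAL
# NEWTON SHELL IN A LOCAL GAUGE** — the twisted sup-small lift `R = liftSMTw k ψ` (★w3) under ABSTRACT frames `ψ`, read through a finest gauge transformation `g` (the stencil gauge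
# `σ_c`): the exact covariance identity `g(b₋)·(liftSMTw ψ u)(b)·g(b₋)* = liftSMTw ψ^g u^g (b)`, and from it the approximate right-inverse row for the FRAMED linearisation
# `T_g(a)(c) = h*·Q^{(k)}(g a g*)(c)·h` of `…NewtonLiftFramedLinearisation` and the curl row at a finest plaquette, each asking the frames to be near the identity ∕ frozen ONLY IN
# THE GAUGE `g` AND ONLY ON THE PAIRS THE KERNEL READS — lane `pub-balaban3d` ∕ cell `ym3-torus`, seat `ym-ust-19936-w4` (g2)

WHY (cell `ym3-torus` 2026-08-28: ★★OWNER g25 02:16:33Z «(r1) of record = ONE global shell with transport frames ψ»; ★w1-19936 g2 LEAD memo v3 §2 + 02:22:38Z (r1-route)∕(r1-σ):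
«frames `ψ(b,c) := Ad(σ_c(b₋)⁻¹σ_c(ĉ₋))` from ANY fine gauge σ_c on (stencil of c) ∩ Ω_fine with ‖U^{σ_c} − 1‖ ≤ η′ — then θ = O(d²Bε) and θ′ = η′ automatically»).  ★w3's twisted port
(`…LinearLiftMatrixTwistS`, `…TwistCurl`) proves `‖Q^{(k)}(liftSMTw ψ A)(c) − A c‖ ≤ (d+1)C_S·θ·M` and the curl row for frames θ-close to the identity ∕ θ′-frozen GLOBALLY; transport
frames of a non-flat field are near the identity only AFTER rotation into the local gauge and only near the bond under repair.  THIS FILE supplies exactly that reading: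
* §1 letters on the kernel: ★ `liftSMTw_congr_frames` (at `b` the lift reads `ψ b c′` only for the cells `c′` within sup-distance 3 of `b₋` — ★w2 g2's `abs_liftS_le_local`),
  ★★ `conj_liftSMTw_eq` (THE COVARIANCE IDENTITY: conjugating the lift at `b₋` by `g` = lifting the rotated data `u^g(c′) = h_{c′} u(c′) h_{c′}*` with the rotated frames
  `ψ^g(b,c′) = Ad(g(b₋)) ∘ ψ(b,c′) ∘ Ad(h_{c′})⁻¹`, `h_{c′} = g^{(k)}(c′₋)`), `norm_liftSMTw_le_sup` (the sup-norm reading `‖liftSMTw ψ u‖ ≤ (C_S∕L^k)·‖u‖` = row (iii) of the shell).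
* §2 ★★★ `norm_framedAvg_liftSMTw_sub_le` — ROW (ii): `‖h*·Q^{(k)}(g·(liftSMTw ψ u)·g*)(c)·h − u(c)‖ ≤ (d+1)C_S·θ·M` as soon as `‖ψ^g(b,c′)Y − Y‖ ≤ θ‖Y‖` for the bonds `b` of the
  two `k`-blocks of `c` and the cells `c′` within 3 of `b₋` (doctored frames + `linAvgIterM_congr₂` + ★w3's `norm_linAvgIterM_liftSMTw_sub_le`).
* §3 ★★ `norm_curlM_conj_liftSMTw_le` — THE CURL ROW IN THE GAUGE `g`: `‖curl(g·(liftSMTw ψ u)·g*)(x;μ,ν)‖ ≤ (4·18^d∕L^{2k})·M + 3(C_S∕L^k)·θ′·M` as soon as `ψ^g(·,c′)` is θ′-frozen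
  across the four bonds of the plaquette for the cells `c′` within 4 of `x` and `ψ` is contractive (doctored frames + ★w3's `norm_curlM_liftSMTw_le`).
HONEST FRAMING.  Finite-dimensional linear algebra over abstract frames; the gauges and their oscillation bounds θ, θ′ are INPUTS ((r1-σ)); the shell's assembly and the START are
NOT here; (FL)∕`hLift`, the stub 2′χ, the crux and any gap are NOT claimed; count-neutral helper toward R3 2′ (items 19936∕19935); registry untouched; nothing about d = 4, the continuum,
or a mass gap; YM₃ on T³ is rung R3, not Clay.

References: T. Bałaban, Commun. Math. Phys. 98 (1985) 17–51 [Balaban1985Averaging] ((9)+(11)–(13) pp.18–19, (19) p.21, p.24); CMP 109 (1987) 249–301 [Balaban1987RG1] ((0.4), (0.11) p.253);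
CMP 102 (1985) 277–309 [Balaban1985Variational] ((8), (15) pp.279–280).
-/

set_option autoImplicit false

noncomputable section

open scoped Matrix.Norms.L2Operator
open NormedSpace
namespace Summit.QuantumFields.YangMills.Theorems.NewtonLiftFramed

open Finset
open Literature.MathematicalPhysics.QuantumFieldTheory.Balaban1983to89
open Literature.MathematicalPhysics.QuantumFieldTheory.Balaban1983to89.B5Eq118OneStroke (iterBlockOf)
open T4Continuum
open Summit.QuantumFields.YangMills.Theorems.LinearLiftMatrix (byEntryTw_def kernel_eq_zero_of_bound liftSMTw liftSMTw_eq linAvgIterM norm_liftSMTw_le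
  norm_linAvgIterM_liftSMTw_sub_le norm_curlM_liftSMTw_le curlM CS CS_nonneg)
open Summit.QuantumFields.YangMills.Theorems.LinearLiftSpread (liftS liftSL liftSL_apply NearR nearR_mono nearR_of_near near_self nearR_shift abs_liftS_le_local)
open Summit.QuantumFields.YangMills.Theorems.PerturbedPlaquette (norm_conj_SU)
open Summit.QuantumFields.YangMills.Theorems.Prop7HolRatioPerStep (coe_star_mul_self coe_mul_star_self)

variable {n : Type*} [Fintype n] [DecidableEq n] {P : Params}

/-! ## §1 Letters on the twisted kernel: frame locality, covariance under a gauge transformation, sup-norm reading -/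

section Kernel

variable (k : ℕ) (hk : k ≤ P.m + P.K)
include hk

omit [Fintype n] [DecidableEq n] in
/-- **★ FRAME LOCALITY OF THE TWISTED LIFT**: at the finest bond `b` the twisted sup-small lift reads the frames `ψ b c′` (and the data `A c′`) only for the coarse bonds `c′` issuing
from a cell within sup-distance `3` of the cell of `b₋` — the kernel of `liftS` vanishes beyond (★w2 g2's `abs_liftS_le_local`). [cite: Balaban1985Averaging, p.24] -/
theorem liftSMTw_congr_frames (ψ ψ' : PBond P 0 → PBond P k → Matrix n n ℂ →ₗ[ℝ] Matrix n n ℂ) (A A' : PBond P k → Matrix n n ℂ) (b : PBond P 0)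
    (h : ∀ c' : PBond P k, NearR k 3 b.src c'.src → ψ b c' (A c') = ψ' b c' (A' c')) : liftSMTw k ψ A b = liftSMTw k ψ' A' b := by
  classical
  rw [liftSMTw_eq, liftSMTw_eq, byEntryTw_def, byEntryTw_def]
  refine sum_congr rfl fun c' _ => ?_
  by_cases hc : NearR k 3 b.src c'.src
  · rw [h c' hc]
  · have h0 := kernel_eq_zero_of_bound (liftSL P k) (fun c' : PBond P k => NearR k 3 b.src c'.src) b
      (C := (18 : ℝ) ^ P.d * (2 + ((P.d : ℝ) + 1) * (18 : ℝ) ^ P.d) / (P.L : ℝ) ^ k)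
      (fun f M' hf => by
        have h := abs_liftS_le_local k hk f b (M := M') fun y μ hy => hf ⟨y, μ⟩ hy
        calc |liftSL P k f b| = |liftS k f b| := rfl
          _ ≤ (18 : ℝ) ^ P.d * (2 + ((P.d : ℝ) + 1) * (18 : ℝ) ^ P.d) * M' / (P.L : ℝ) ^ k := h
          _ = (18 : ℝ) ^ P.d * (2 + ((P.d : ℝ) + 1) * (18 : ℝ) ^ P.d) / (P.L : ℝ) ^ k * M' := by ring) hc
    rw [h0, zero_smul, zero_smul]

/-- **★★ THE COVARIANCE IDENTITY OF THE TWISTED LIFT**: for a finest gauge transformation `g` and unitaries `h_{c′}` at the coarse bonds, conjugating the lift at `b₋` is lifting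
the rotated data with the rotated frames: `g(b₋)·(liftSMTw ψ u)(b)·g(b₋)* = liftSMTw ψ′ u′ (b)` whenever `ψ′ b c′ Y = g(b₋)·ψ b c′ (h_{c′}*·Y·h_{c′})·g(b₋)*` and
`u′ c′ = h_{c′}·u c′·h_{c′}*` (the sum is finite and conjugation is linear). [cite: Balaban1985Averaging, (11)–(13) p.19] -/
theorem conj_liftSMTw_eq (ψ ψ' : PBond P 0 → PBond P k → Matrix n n ℂ →ₗ[ℝ] Matrix n n ℂ) (g : GaugeTransf P 0 (Matrix.specialUnitaryGroup n ℂ))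
    (h : PBond P k → Matrix.specialUnitaryGroup n ℂ) (u u' : PBond P k → Matrix n n ℂ) (b : PBond P 0)
    (hψ' : ∀ (c' : PBond P k) (Y : Matrix n n ℂ), NearR k 3 b.src c'.src →
      ψ' b c' Y = (g b.src : Matrix n n ℂ) * ψ b c' (star (h c' : Matrix n n ℂ) * Y * (h c' : Matrix n n ℂ)) * star (g b.src : Matrix n n ℂ))
    (hu' : ∀ c' : PBond P k, NearR k 3 b.src c'.src → u' c' = (h c' : Matrix n n ℂ) * u c' * star (h c' : Matrix n n ℂ)) :
    (g b.src : Matrix n n ℂ) * liftSMTw k ψ u b * star (g b.src : Matrix n n ℂ) = liftSMTw k ψ' u' b := by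
  classical
  -- replace `ψ′, u′` by their values on the read pairs
  let ψ'' : PBond P 0 → PBond P k → Matrix n n ℂ →ₗ[ℝ] Matrix n n ℂ := fun b₁ c' =>
    (LinearMap.mulLeftRight ℝ ((g b₁.src : Matrix n n ℂ), star (g b₁.src : Matrix n n ℂ))).comp
      ((ψ b₁ c').comp (LinearMap.mulLeftRight ℝ (star (h c' : Matrix n n ℂ), (h c' : Matrix n n ℂ))))
  have hψ'' : ∀ (b₁ : PBond P 0) (c' : PBond P k) (Y : Matrix n n ℂ),
      ψ'' b₁ c' Y = (g b₁.src : Matrix n n ℂ) * ψ b₁ c' (star (h c' : Matrix n n ℂ) * Y * (h c' : Matrix n n ℂ)) * star (g b₁.src : Matrix n n ℂ) := by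
    intro b₁ c' Y
    simp only [ψ'', LinearMap.comp_apply, LinearMap.mulLeftRight_apply]
  have e : liftSMTw k ψ' u' b = liftSMTw k ψ'' (fun c' => (h c' : Matrix n n ℂ) * u c' * star (h c' : Matrix n n ℂ)) b :=
    liftSMTw_congr_frames k hk ψ' ψ'' u' _ b fun c' hc => by rw [hψ' c' _ hc, hu' c' hc, hψ'']
  rw [e, liftSMTw_eq, liftSMTw_eq, byEntryTw_def, byEntryTw_def, mul_sum, sum_mul]
  refine sum_congr rfl fun c' _ => ?_
  rw [hψ'', mul_smul_comm, smul_mul_assoc]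
  congr 1
  have f : star (h c' : Matrix n n ℂ) * ((h c' : Matrix n n ℂ) * u c' * star (h c' : Matrix n n ℂ)) * (h c' : Matrix n n ℂ) =
      (star (h c' : Matrix n n ℂ) * (h c' : Matrix n n ℂ)) * u c' * (star (h c' : Matrix n n ℂ) * (h c' : Matrix n n ℂ)) := by noncomm_ring
  rw [f, coe_star_mul_self, one_mul, mul_one]

/-- **ROW (iii) OF THE SHELL — THE SUP-NORM READING OF THE TWISTED LIFT**: for contractive frames `‖liftSMTw k ψ u‖ ≤ (C_S∕L^k)·‖u‖` (sup norms; ★w3's `norm_liftSMTw_le`).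
[cite: Balaban1987RG1, (0.4)+(0.11) p.253] -/
theorem norm_liftSMTw_le_sup (ψ : PBond P 0 → PBond P k → Matrix n n ℂ →ₗ[ℝ] Matrix n n ℂ) (hψ : ∀ b c X, ‖ψ b c X‖ ≤ ‖X‖) (u : PBond P k → Matrix n n ℂ) :
    ‖liftSMTw k ψ u‖ ≤ (CS P / (P.L : ℝ) ^ k) * ‖u‖ :=
  (pi_norm_le_iff_of_nonneg (mul_nonneg (div_nonneg (CS_nonneg P) (by positivity)) (norm_nonneg _))).2 fun b =>
    norm_liftSMTw_le k ψ hk hψ u (fun c => norm_le_pi_norm u c) b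

end Kernel

/-! ## §2 Row (ii): the framed linearised average of the twisted lift returns the datum, up to `(d+1)·C_S·θ` -/

section RowTwo

variable [Nonempty n] {k : ℕ} (hk : k ≤ P.m + P.K)
include hk

/-- **★★★ ROW (ii) OF THE REGIONAL SHELL, IN THE LOCAL GAUGE `g`** (`k ≤ m + K`).  Frames `ψ`, a finest gauge transformation `g` (the stencil gauge of the coarse bond `c`), restricted
gauge `h_{c′} = g^{(k)}(c′₋)`; data `‖u c′‖ ≤ M`.  Suppose the ROTATED frames are `θ`-close to the identity ON THE PAIRS READ AT `c`: for every finest bond `b` with both ends in the two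
`k`-blocks of `c` and every `c′` from a cell within 3 of `b₋`, `‖g(b₋)·ψ b c′ (h_{c′}*·Y·h_{c′})·g(b₋)* − Y‖ ≤ θ‖Y‖`.  THEN
`‖h_c*·Q^{(k)}(b ↦ g(b₋)·(liftSMTw ψ u)(b)·g(b₋)*)(c)·h_c − u(c)‖ ≤ ((d+1)·C_S)·(θ·M)` — i.e. `T_g(R u)(c) = u(c) + O(θ)‖u‖` for the framed linearisation `T_g` of
`…NewtonLiftFramedLinearisation` and ★w3's kernel `R = liftSMTw k ψ`; NO `k`, NO `L` in the constant.  (Covariance identity; doctored frames equal to the rotated ones on the read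
pairs and to the identity elsewhere; `linAvgIterM_congr₂`; ★w3's `norm_linAvgIterM_liftSMTw_sub_le`.) [cite: Balaban1985Averaging, (11)–(13) p.19; Balaban1987RG1, (0.4)+(0.11) p.253] -/
theorem norm_framedAvg_liftSMTw_sub_le (c : PBond P k) (ψ : PBond P 0 → PBond P k → Matrix n n ℂ →ₗ[ℝ] Matrix n n ℂ)
    (g : GaugeTransf P 0 (Matrix.specialUnitaryGroup n ℂ)) (u : PBond P k → Matrix n n ℂ) {M θ : ℝ} (hM : ∀ c', ‖u c'‖ ≤ M) (hθ : 0 ≤ θ)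
    (hψ : ∀ b : PBond P 0, (iterBlockOf k b.src = c.src ∨ iterBlockOf k b.src = c.tgt) → (iterBlockOf k b.tgt = c.src ∨ iterBlockOf k b.tgt = c.tgt) →
      ∀ c' : PBond P k, NearR k 3 b.src c'.src → ∀ Y : Matrix n n ℂ,
        ‖(g b.src : Matrix n n ℂ) * ψ b c' (star (transfUp g k c'.src : Matrix n n ℂ) * Y * (transfUp g k c'.src : Matrix n n ℂ)) * star (g b.src : Matrix n n ℂ) - Y‖ ≤ θ * ‖Y‖) :
    ‖star (transfUp g k c.src : Matrix n n ℂ) * linAvgIterM k (fun b => (g b.src : Matrix n n ℂ) * liftSMTw k ψ u b * star (g b.src : Matrix n n ℂ)) c *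
        (transfUp g k c.src : Matrix n n ℂ) - u c‖ ≤ (((P.d : ℝ) + 1) * CS P) * (θ * M) := by
  classical
  -- the rotated data and the doctored rotated frames
  let Rd : PBond P 0 → Prop := fun b => (iterBlockOf k b.src = c.src ∨ iterBlockOf k b.src = c.tgt) ∧ (iterBlockOf k b.tgt = c.src ∨ iterBlockOf k b.tgt = c.tgt)
  let u' : PBond P k → Matrix n n ℂ := fun c' => (transfUp g k c'.src : Matrix n n ℂ) * u c' * star (transfUp g k c'.src : Matrix n n ℂ)
  let ψg : PBond P 0 → PBond P k → Matrix n n ℂ →ₗ[ℝ] Matrix n n ℂ := fun b c' =>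
    (LinearMap.mulLeftRight ℝ ((g b.src : Matrix n n ℂ), star (g b.src : Matrix n n ℂ))).comp
      ((ψ b c').comp (LinearMap.mulLeftRight ℝ (star (transfUp g k c'.src : Matrix n n ℂ), (transfUp g k c'.src : Matrix n n ℂ))))
  have hψg : ∀ (b : PBond P 0) (c' : PBond P k) (Y : Matrix n n ℂ),
      ψg b c' Y = (g b.src : Matrix n n ℂ) * ψ b c' (star (transfUp g k c'.src : Matrix n n ℂ) * Y * (transfUp g k c'.src : Matrix n n ℂ)) * star (g b.src : Matrix n n ℂ) := by
    intro b c' Y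
    simp only [ψg, LinearMap.comp_apply, LinearMap.mulLeftRight_apply]
  let ψd : PBond P 0 → PBond P k → Matrix n n ℂ →ₗ[ℝ] Matrix n n ℂ := fun b c' => if Rd b ∧ NearR k 3 b.src c'.src then ψg b c' else LinearMap.id
  -- the doctored frames are `θ`-close to the identity everywhere
  have hψd : ∀ b c' Y, ‖ψd b c' Y - Y‖ ≤ θ * ‖Y‖ := by
    intro b c' Y
    by_cases hb : Rd b ∧ NearR k 3 b.src c'.src
    · have e : ψd b c' = ψg b c' := if_pos hb
      rw [e, hψg]; exact hψ b hb.1.1 hb.1.2 c' hb.2 Y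
    · have e : ψd b c' = LinearMap.id := if_neg hb
      rw [e, LinearMap.id_apply, sub_self, norm_zero]; positivity
  have hu' : ∀ c', ‖u' c'‖ ≤ M := fun c' => by simp only [u']; rw [norm_conj_SU]; exact hM c'
  -- covariance, then locality: the framed average of the lift is the flat average of the doctored twisted lift of the rotated data
  have hcov : ∀ b : PBond P 0, Rd b → (g b.src : Matrix n n ℂ) * liftSMTw k ψ u b * star (g b.src : Matrix n n ℂ) = liftSMTw k ψd u' b := by
    intro b hb
    refine conj_liftSMTw_eq k hk ψ ψd g (fun c' => transfUp g k c'.src) u u' b (fun c' Y hc => ?_) (fun c' _ => rfl)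
    have e : ψd b c' = ψg b c' := if_pos ⟨hb, hc⟩
    rw [e, hψg]
  have hloc : linAvgIterM k (fun b => (g b.src : Matrix n n ℂ) * liftSMTw k ψ u b * star (g b.src : Matrix n n ℂ)) c = linAvgIterM k (liftSMTw k ψd u') c :=
    linAvgIterM_congr₂ hk _ _ c fun b h1 h2 => hcov b ⟨h1, h2⟩
  -- ★w3's exactness defect for the doctored frames
  have hw3 := norm_linAvgIterM_liftSMTw_sub_le k ψd hk hθ hψd u' hu' c
  -- rotate back
  rw [hloc, norm_sub_rev, norm_sub_conj_eq, norm_sub_rev]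
  exact hw3

end RowTwo

/-! ## §3 The curl row of the conjugated twisted lift at a finest plaquette -/

section Curl

variable {k : ℕ} (hk : k ≤ P.m + P.K)
include hk

/-- **★★ THE CURL ROW IN THE LOCAL GAUGE `g`** (`k ≤ m + K`).  Contractive frames `ψ` (`‖ψ b c′ X‖ ≤ ‖X‖`, e.g. `Ad` of unitaries), a finest gauge transformation `g`, restricted
gauge `h_{c′} = g^{(k)}(c′₋)`, data `‖u c′‖ ≤ M`, a finest plaquette at `(x; μ, ν)`, `μ ≠ ν`.  Suppose the ROTATED frames `ψ^g(b,c′)Y = g(b₋)·ψ b c′(h_{c′}*Yh_{c′})·g(b₋)*` are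
`θ′`-FROZEN across the plaquette ON THE CELLS WITHIN 4 OF `x`: `‖ψ^g(bᵢ,c′)Y − ψ^g(b₁,c′)Y‖ ≤ θ′‖Y‖` for `b₁ = (x,μ)`, `bᵢ ∈ {(x+e_μ,ν), (x+e_ν,μ), (x,ν)}` and `c′` with `NearR k 4 x c′₋`.
THEN `‖curl(b ↦ g(b₋)·(liftSMTw ψ u)(b)·g(b₋)*)(x;μ,ν)‖ ≤ (4·18^d∕(L^k)²)·M + 3·((C_S∕L^k)·(θ′·M))` — ★w3's (r1-curl) row read in the gauge where the transport frames ARE frozen.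
(Covariance identity; doctored frames; `nearR_shift`.) [cite: Balaban1985Averaging, (9)+(11) pp.18–19; Balaban1987RG1, (0.4)+(0.11) p.253] -/
theorem norm_curlM_conj_liftSMTw_le (ψ : PBond P 0 → PBond P k → Matrix n n ℂ →ₗ[ℝ] Matrix n n ℂ) (hψc : ∀ b c X, ‖ψ b c X‖ ≤ ‖X‖)
    (g : GaugeTransf P 0 (Matrix.specialUnitaryGroup n ℂ)) (u : PBond P k → Matrix n n ℂ) {M θ' : ℝ} (hM : ∀ c', ‖u c'‖ ≤ M) (hθ' : 0 ≤ θ')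
    (x : Site P 0) {μ ν : Fin P.d} (hμν : μ ≠ ν)
    (hψ : ∀ b : PBond P 0, (b = ⟨x.shift μ, ν⟩ ∨ b = ⟨x.shift ν, μ⟩ ∨ b = ⟨x, ν⟩) → ∀ c' : PBond P k, NearR k 4 x c'.src → ∀ Y : Matrix n n ℂ,
      ‖(g b.src : Matrix n n ℂ) * ψ b c' (star (transfUp g k c'.src : Matrix n n ℂ) * Y * (transfUp g k c'.src : Matrix n n ℂ)) * star (g b.src : Matrix n n ℂ) -
          (g x : Matrix n n ℂ) * ψ ⟨x, μ⟩ c' (star (transfUp g k c'.src : Matrix n n ℂ) * Y * (transfUp g k c'.src : Matrix n n ℂ)) * star (g x : Matrix n n ℂ)‖ ≤ θ' * ‖Y‖) :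
    ‖curlM (fun b => (g b.src : Matrix n n ℂ) * liftSMTw k ψ u b * star (g b.src : Matrix n n ℂ)) x μ ν‖ ≤
      (4 * (18 : ℝ) ^ P.d / ((P.L : ℝ) ^ k) ^ 2) * M + 3 * ((CS P / (P.L : ℝ) ^ k) * (θ' * M)) := by
  classical
  -- the rotated data and the doctored rotated frames (rotated on the cells within 4 of `x`, trivial elsewhere)
  let u' : PBond P k → Matrix n n ℂ := fun c' => (transfUp g k c'.src : Matrix n n ℂ) * u c' * star (transfUp g k c'.src : Matrix n n ℂ)
  let ψg : PBond P 0 → PBond P k → Matrix n n ℂ →ₗ[ℝ] Matrix n n ℂ := fun b c' =>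
    (LinearMap.mulLeftRight ℝ ((g b.src : Matrix n n ℂ), star (g b.src : Matrix n n ℂ))).comp
      ((ψ b c').comp (LinearMap.mulLeftRight ℝ (star (transfUp g k c'.src : Matrix n n ℂ), (transfUp g k c'.src : Matrix n n ℂ))))
  have hψg : ∀ (b : PBond P 0) (c' : PBond P k) (Y : Matrix n n ℂ),
      ψg b c' Y = (g b.src : Matrix n n ℂ) * ψ b c' (star (transfUp g k c'.src : Matrix n n ℂ) * Y * (transfUp g k c'.src : Matrix n n ℂ)) * star (g b.src : Matrix n n ℂ) := by
    intro b c' Y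
    simp only [ψg, LinearMap.comp_apply, LinearMap.mulLeftRight_apply]
  let ψd : PBond P 0 → PBond P k → Matrix n n ℂ →ₗ[ℝ] Matrix n n ℂ := fun b c' => if NearR k 4 x c'.src then ψg b c' else LinearMap.id
  have hψd_of : ∀ b c', NearR k 4 x c'.src → ψd b c' = ψg b c' := fun b c' hc => if_pos hc
  have hψd_not : ∀ b c', ¬ NearR k 4 x c'.src → ψd b c' = LinearMap.id := fun b c' hc => if_neg hc
  -- the doctored frames are contractive and `θ′`-frozen across the plaquette everywhere
  have hψgc : ∀ b c' Y, ‖ψg b c' Y‖ ≤ ‖Y‖ := by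
    intro b c' Y
    rw [hψg, norm_conj_SU]
    refine (hψc b c' _).trans (le_of_eq ?_)
    rw [CStarRing.norm_mul_mem_unitary _ (transfUp g k c'.src).2.1, CStarRing.norm_mem_unitary_mul _ (Unitary.star_mem (transfUp g k c'.src).2.1)]
  have hψdc : ∀ b c' Y, ‖ψd b c' Y‖ ≤ ‖Y‖ := by
    intro b c' Y
    by_cases hc : NearR k 4 x c'.src
    · rw [hψd_of b c' hc]; exact hψgc b c' Y
    · rw [hψd_not b c' hc, LinearMap.id_apply]
  have hfro : ∀ b : PBond P 0, (b = ⟨x.shift μ, ν⟩ ∨ b = ⟨x.shift ν, μ⟩ ∨ b = ⟨x, ν⟩) → ∀ c' Y, ‖ψd b c' Y - ψd ⟨x, μ⟩ c' Y‖ ≤ θ' * ‖Y‖ := by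
    intro b hb c' Y
    by_cases hc : NearR k 4 x c'.src
    · rw [hψd_of b c' hc, hψd_of _ c' hc, hψg, hψg]; exact hψ b hb c' hc Y
    · rw [hψd_not b c' hc, hψd_not _ c' hc, sub_self, norm_zero]; positivity
  have hu' : ∀ c', ‖u' c'‖ ≤ M := fun c' => by simp only [u']; rw [norm_conj_SU]; exact hM c'
  -- covariance + frame locality on the four bonds (each base site is within one step of `x`)
  have hcov : ∀ b : PBond P 0, (∀ y : Site P k, NearR k 3 b.src y → NearR k 4 x y) →
      (g b.src : Matrix n n ℂ) * liftSMTw k ψ u b * star (g b.src : Matrix n n ℂ) = liftSMTw k ψd u' b := by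
    intro b hb
    refine conj_liftSMTw_eq k hk ψ ψd g (fun c' => transfUp g k c'.src) u u' b (fun c' Y hc => ?_) (fun c' _ => rfl)
    rw [hψd_of b c' (hb _ hc), hψg]
  have hx : ∀ y : Site P k, NearR k 3 x y → NearR k 4 x y := fun y hy => nearR_mono k (by norm_num) hy
  have hxμ : ∀ y : Site P k, NearR k 3 (x.shift μ) y → NearR k 4 x y := fun y hy => nearR_shift k hk hy
  have hxν : ∀ y : Site P k, NearR k 3 (x.shift ν) y → NearR k 4 x y := fun y hy => nearR_shift k hk hy
  set F : PBond P 0 → Matrix n n ℂ := fun b => (g b.src : Matrix n n ℂ) * liftSMTw k ψ u b * star (g b.src : Matrix n n ℂ) with hF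
  have h1 : F ⟨x, μ⟩ = liftSMTw k ψd u' ⟨x, μ⟩ := hcov ⟨x, μ⟩ hx
  have h2 : F ⟨x.shift μ, ν⟩ = liftSMTw k ψd u' ⟨x.shift μ, ν⟩ := hcov ⟨x.shift μ, ν⟩ hxμ
  have h3 : F ⟨x.shift ν, μ⟩ = liftSMTw k ψd u' ⟨x.shift ν, μ⟩ := hcov ⟨x.shift ν, μ⟩ hxν
  have h4 : F ⟨x, ν⟩ = liftSMTw k ψd u' ⟨x, ν⟩ := hcov ⟨x, ν⟩ hx
  have e : curlM F x μ ν = curlM (liftSMTw k ψd u') x μ ν := by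
    rw [show curlM F x μ ν = F ⟨x, μ⟩ + F ⟨x.shift μ, ν⟩ - F ⟨x.shift ν, μ⟩ - F ⟨x, ν⟩ from rfl, h1, h2, h3, h4]
    rfl
  rw [e]
  exact norm_curlM_liftSMTw_le k ψd hk hψdc u' hu' x hμν hθ' (hfro _ (Or.inl rfl)) (hfro _ (Or.inr (Or.inl rfl))) (hfro _ (Or.inr (Or.inr rfl)))

end Curl

end Summit.QuantumFields.YangMills.Theorems.NewtonLiftFramed

end
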